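import Mathlib.Order.Filter.AtTopBot.Basic
import Mathlib.Topology.Order.Basic
import Mathlib.Topology.Separation.Hausdorff
import Mathlib.Data.Fintype.Pi
import Mathlib.Data.Fintype.BigOperators
import Mathlib.Data.Pi.Interval
import Mathlib.Order.Interval.Finset.Basic
import Mathlib.Data.Int.Interval
import Literature.Probability.LatticeModels.LatticeGraph
import HarnessLib

-- provenance: harness21/H21/H21/Prelude/StatMech/ThermodynamicLimit.lean @ bd548d0 (interim HEAD d8f2665); M5 mechanical rewrite
/-!
# Boxes in `ℤ^d` and thermodynamic (infinite-volume) limits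

This file provides the finite-volume bookkeeping used by the infinite-volume statements of the
lattice models of this library:

* `box d L = {-L, …, L}^d ⊆ ℤ^d`, the centred cube of side `2L+1` (Friedli–Velenik 2017, §3.2,
  `B(n)`), with `card_box`, `box_mono`, `zero_mem_box`, `iUnion_coe_box`; the half-open cube
  `halfOpenBox d L = {0, …, L-1}^d`; the cubic annulus `annulus d r R = box d R \ box d r`.
* `vanHove d`, the filter on `Finset (Site d)` of *convergence in the sense of van Hove*
  (`Λ ⇑ ℤ^d`: `Λ` eventually contains every finite set and `|∂ᵉˣΛ| / |Λ| → 0`;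
  Friedli–Velenik 2017, §3.2.1, eq. (3.4); Ruelle, *Statistical Mechanics* (1969), §2.1), with
  `tendsto_box_vanHove` (boxes converge in the sense of van Hove) and `vanHove_neBot`.
* `perSite f Λ = f Λ / |Λ|` (densities), the limit predicates `HasBoxLimit f a`
  (`f (box d L) → a` as `L → ∞`) and `HasVanHoveLimit f a` (`f → a` along `vanHove d`), and the
  junk-valued limit `boxLim f := limUnder atTop (f ∘ box d)` together with
  `boxLim_eq_of_hasBoxLimit`.

Design choices. Both the box limit (a `Tendsto` along
`atTop : Filter ℕ`) and a genuine van Hove filter are provided; infinite-volume *values* are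
`limUnder` (junk if the limit does not exist, always accompanied by an existence theorem where it
is used). `box` is defined through `Fintype.piFinset`; it coincides with
Mathlib's `Finset.Icc (-L) L` for the product locally finite order on `Fin d → ℤ`
(`Pi.Icc_eq`, see `box_eq_Icc`).

Mathlib anchors used rather than re-defined: `Fintype.piFinset`, `Fintype.card_piFinset_const`,
`Int.card_Icc`, `Pi.Icc_eq`, `Filter.atTop`, `Filter.limUnder`, `Filter.Tendsto.limUnder_eq`,
`nhds`. Mathlib's `Finset.box n` (Order/Interval/Finset/Box.lean) is the *hollow* shell
`Icc (-n) n \ Icc (-(n-1)) (n-1)` of a locally finite ordered ring, not the full cube, and there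
is no van Hove filter in Mathlib; hence the definitions below.
-/

namespace Literature.Probability.LatticeModels

open Finset Filter Topology

variable {d : ℕ}

/-! ### Boxes -/

/-- The centred cube `box d L = {-L, …, L}^d ⊆ ℤ^d` of side length `2L+1`
(Friedli–Velenik 2017, §3.2.1, `B(n) = {-n,…,n}^d`, after eq. (3.3)). [cite: FriedliVelenikSMLS2017, §3.2.1 (the boxes B(n), after eq. (3.3))] -/
noncomputable def box (d L : ℕ) : Finset (Site d) :=
  Fintype.piFinset fun _ => Finset.Icc (-(L : ℤ)) L

/-- Membership in `box d L`: every coordinate lies in `[-L, L]`. (Friedli–Velenik 2017, §3.2.) [cite: FriedliVelenikSMLS2017, §3.2] -/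
@[simp] theorem mem_box {L : ℕ} {x : Site d} : x ∈ box d L ↔ ∀ i, -(L : ℤ) ≤ x i ∧ x i ≤ L := by
  simp [box, Fintype.mem_piFinset]

/-- `box d L` is Mathlib's order interval `Icc (-L) L` for the product order on `Fin d → ℤ`
(`Pi.Icc_eq`). (Friedli–Velenik 2017, §3.2.) [cite: FriedliVelenikSMLS2017, §3.2] -/
theorem box_eq_Icc (d L : ℕ) : box d L = Finset.Icc (-(L : Site d)) (L : Site d) := by
  rw [Pi.Icc_eq]; rfl

/-- `|box d L| = (2L+1)^d`. (Friedli–Velenik 2017, §3.2.) [cite: FriedliVelenikSMLS2017, §3.2] -/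
theorem card_box (d L : ℕ) : #(box d L) = (2 * L + 1) ^ d := by
  rw [box, Fintype.card_piFinset_const, Int.card_Icc]
  congr 1
  omega

/-- Boxes are increasing in `L`. (Friedli–Velenik 2017, §3.2.) [cite: FriedliVelenikSMLS2017, §3.2] -/
theorem box_mono (d : ℕ) : Monotone (box d) := by
  intro L L' h x hx
  rw [mem_box] at hx ⊢
  intro i
  obtain ⟨h₁, h₂⟩ := hx i
  constructor <;> omega

/-- The origin belongs to every box. (Friedli–Velenik 2017, §3.2.) [cite: FriedliVelenikSMLS2017, §3.2] -/
theorem zero_mem_box (d L : ℕ) : (0 : Site d) ∈ box d L := by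
  simp

/-- `box d L` is nonempty. (Friedli–Velenik 2017, §3.2.) [cite: FriedliVelenikSMLS2017, §3.2] -/
theorem box_nonempty (d L : ℕ) : (box d L).Nonempty := ⟨0, zero_mem_box d L⟩

/-- The boxes exhaust `ℤ^d`: `⋃_L box d L = ℤ^d`. (Friedli–Velenik 2017, §3.2.) [cite: FriedliVelenikSMLS2017, §3.2] -/
theorem iUnion_coe_box (d : ℕ) :
    ⋃ L : ℕ, ((box d L : Finset (Site d)) : Set (Site d)) = Set.univ := by
  refine Set.eq_univ_of_forall fun x => Set.mem_iUnion.2 ?_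
  classical
  refine ⟨Finset.univ.sup fun i => (x i).natAbs, ?_⟩
  rw [Finset.mem_coe, mem_box]
  intro i
  have h : (x i).natAbs ≤ Finset.univ.sup fun i => (x i).natAbs :=
    Finset.le_sup (f := fun i => (x i).natAbs) (Finset.mem_univ i)
  omega

/-- The half-open cube `{0, …, L-1}^d ⊆ ℤ^d` of side length `L` (empty for `L = 0` when
`d ≠ 0`). (Friedli–Velenik 2017, §3.2; used for block/torus comparisons.) [cite: FriedliVelenikSMLS2017, §3.2] -/
noncomputable def halfOpenBox (d L : ℕ) : Finset (Site d) :=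
  Fintype.piFinset fun _ => Finset.Ico (0 : ℤ) L

/-- Membership in `halfOpenBox d L`: every coordinate lies in `[0, L)`.
(Friedli–Velenik 2017, §3.2.) [cite: FriedliVelenikSMLS2017, §3.2] -/
@[simp] theorem mem_halfOpenBox {L : ℕ} {x : Site d} :
    x ∈ halfOpenBox d L ↔ ∀ i, 0 ≤ x i ∧ x i < L := by
  simp [halfOpenBox, Fintype.mem_piFinset]

/-- `|halfOpenBox d L| = L^d`. (Friedli–Velenik 2017, §3.2.) [cite: FriedliVelenikSMLS2017, §3.2] -/
theorem card_halfOpenBox (d L : ℕ) : #(halfOpenBox d L) = L ^ d := by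
  rw [halfOpenBox, Fintype.card_piFinset_const, Int.card_Ico]
  simp

/-- The cubic annulus `box d R \ box d r = {x | r < ‖x‖_∞ ≤ R}` (empty unless `r < R`).
(Cf. Friedli–Velenik 2017, §3.7; percolation arm events, Grimmett 1999, §9.) [cite: FriedliVelenikSMLS2017, §3.7] -/
noncomputable def annulus (d r R : ℕ) : Finset (Site d) := box d R \ box d r

/-- Membership in the annulus. (Friedli–Velenik 2017, §3.7.) [cite: FriedliVelenikSMLS2017, §3.7] -/
@[simp] theorem mem_annulus {r R : ℕ} {x : Site d} :
    x ∈ annulus d r R ↔ x ∈ box d R ∧ x ∉ box d r := mem_sdiff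

/-! ### The van Hove filter -/

/-- Convergence to `ℤ^d` *in the sense of van Hove* as a filter on finite volumes: `Λ → ℤ^d`
along `vanHove d` iff `Λ` eventually contains every finite set `K` and, for every `ε > 0`,
eventually `|∂ᵉˣΛ| ≤ ε |Λ|`. (Friedli–Velenik 2017, §3.2.1, eq. (3.3), there with `∂ⁱⁿΛ`;
Ruelle 1969, §2.1.) [cite: FriedliVelenikSMLS2017, §3.2.1 eq. (3.3)] -/
noncomputable def vanHove (d : ℕ) : Filter (Finset (Site d)) :=
  ⨅ ε > (0 : ℝ), ⨅ K : Finset (Site d),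
    𝓟 {Λ | K ⊆ Λ ∧ (#(outerBoundary (zdGraph d) Λ) : ℝ) ≤ ε * #Λ}

/-- Unfolding of `Tendsto u l (vanHove d)`. (Friedli–Velenik 2017, §3.2.1.) [cite: FriedliVelenikSMLS2017, §3.2.1] -/
theorem tendsto_vanHove_iff {ι : Type*} {l : Filter ι} {u : ι → Finset (Site d)} :
    Tendsto u l (vanHove d) ↔
      ∀ ε : ℝ, 0 < ε → ∀ K : Finset (Site d),
        ∀ᶠ n in l, K ⊆ u n ∧ (#(outerBoundary (zdGraph d) (u n)) : ℝ) ≤ ε * #(u n) := by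
  simp only [vanHove, tendsto_iInf, tendsto_principal, Set.mem_setOf_eq]

/-- The boxes `box d L` converge to `ℤ^d` in the sense of van Hove
(`|∂ᵉˣB(n)| / |B(n)| = O(1/n)`). (Friedli–Velenik 2017, §3.2.1, Exercise 3.1 after eq. (3.3).)
[cite: FriedliVelenikSMLS2017, §3.2.1 Exercise 3.1] -/
def tendsto_box_vanHove : Prop :=
  ∀ (d : ℕ),
    Tendsto (box d) atTop (vanHove d)

/-- The van Hove filter is nontrivial (it contains the image of `atTop` under `box d`).
(Friedli–Velenik 2017, §3.2.1.) [cite: FriedliVelenikSMLS2017, §3.2.1] -/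
def vanHove_neBot : Prop :=
  ∀ (d : ℕ),
    (vanHove d).NeBot

-- Proved in `ThermodynamicLimitProofs.lean` (`vanHove_neBot_holds`), from `tendsto_box_vanHove`.

/-- Along the van Hove filter, every finite set is eventually contained in `Λ`.
(Friedli–Velenik 2017, §3.2.1.) [cite: FriedliVelenikSMLS2017, §3.2.1] -/
theorem eventually_subset_of_vanHove (K : Finset (Site d)) : ∀ᶠ Λ in vanHove d, K ⊆ Λ :=
  ((tendsto_vanHove_iff.1 tendsto_id) 1 one_pos K).mono fun _ h => h.1

/-- Every finite subset of `ℤ^d` is eventually contained in the boxes.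
(Friedli–Velenik 2017, §3.2.) [cite: FriedliVelenikSMLS2017, §3.2] -/
def eventually_subset_box : Prop :=
  ∀ (K : Finset (Site d)),
    ∀ᶠ L in atTop, K ⊆ box d L

-- Proved as `eventually_subset_box_holds` (`GKSInequalities.lean`).

/-! ### Densities and limits -/

/-- The per-site density `f Λ / |Λ|` of an extensive quantity `f` (e.g. `log Z_Λ / |Λ|`).
Junk value `f ∅ / 0 = 0` for `Λ = ∅` (Mathlib division convention). (Friedli–Velenik 2017,
§3.2.2, Definition 3.4: the pressure in `Λ` is `|Λ|⁻¹ log Z_Λ`.) [cite: FriedliVelenikSMLS2017, §3.2.2 Definition 3.4] -/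
def perSite {V 𝕜 : Type*} [DivisionRing 𝕜] (f : Finset V → 𝕜) (Λ : Finset V) : 𝕜 :=
  f Λ / (#Λ : 𝕜)

/-- `perSite f Λ = f Λ / |Λ|`. (Friedli–Velenik 2017, Definition 3.5.) [cite: FriedliVelenikSMLS2017, Definition 3.5] -/
@[simp] theorem perSite_apply {V 𝕜 : Type*} [DivisionRing 𝕜] (f : Finset V → 𝕜) (Λ : Finset V) :
    perSite f Λ = f Λ / (#Λ : 𝕜) := rfl

section Limits

variable {α : Type*} [TopologicalSpace α]

/-- `HasBoxLimit f a`: the finite-volume quantity `f` converges to `a` along the boxes,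
`f (box d L) → a` as `L → ∞`. (Friedli–Velenik 2017, §3.2.1, thermodynamic limit along
`B(n) ↑ ℤ^d`.) [cite: FriedliVelenikSMLS2017, §3.2.1 (thermodynamic limit along B(n))] -/
def HasBoxLimit (f : Finset (Site d) → α) (a : α) : Prop :=
  Tendsto (fun L : ℕ => f (box d L)) atTop (𝓝 a)

/-- `HasVanHoveLimit f a`: `f Λ → a` as `Λ ⇑ ℤ^d` in the sense of van Hove.
(Friedli–Velenik 2017, §3.2.1, eq. (3.3); as in Theorem 3.6 for the pressure.)
[cite: FriedliVelenikSMLS2017, §3.2.1 eq. (3.3) and Theorem 3.6] -/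
def HasVanHoveLimit (f : Finset (Site d) → α) (a : α) : Prop :=
  Tendsto f (vanHove d) (𝓝 a)

/-- A van Hove limit is in particular a limit along boxes (`tendsto_box_vanHove`).
(Friedli–Velenik 2017, §3.2.1.) [cite: FriedliVelenikSMLS2017, §3.2.1] -/
def HasVanHoveLimit.hasBoxLimit : Prop :=
  ∀ {f : Finset (Site d) → α} {a : α} (h : HasVanHoveLimit f a),
    HasBoxLimit f a

-- Proved in `ThermodynamicLimitProofs.lean` (`HasVanHoveLimit.hasBoxLimit_holds`), by composing with `tendsto_box_vanHove`.

/-- The infinite-volume value `lim_{L → ∞} f (box d L)` as a term, via `Filter.limUnder`.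
**Junk-valued**: if `f ∘ box d` does not converge this is an arbitrary (classically chosen)
point of `α`; meaningful statements either assume/prove `HasBoxLimit f a` or use
`boxLim_eq_of_hasBoxLimit`. (Friedli–Velenik 2017, §3.2.1.) [cite: FriedliVelenikSMLS2017, §3.2.1] -/
noncomputable def boxLim [Nonempty α] (f : Finset (Site d) → α) : α :=
  limUnder atTop (f ∘ box d)

/-- If `f` has box limit `a` then `boxLim f = a` (Hausdorff codomain).
(Friedli–Velenik 2017, §3.2.1; Mathlib `Filter.Tendsto.limUnder_eq`.) [cite: FriedliVelenikSMLS2017, §3.2.1] -/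
theorem boxLim_eq_of_hasBoxLimit [T2Space α] [Nonempty α] {f : Finset (Site d) → α} {a : α}
    (h : HasBoxLimit f a) : boxLim f = a :=
  h.limUnder_eq

/-- If `f` has some box limit then it converges to `boxLim f`.
(Friedli–Velenik 2017, §3.2.1; Mathlib `tendsto_nhds_limUnder`.) [cite: FriedliVelenikSMLS2017, §3.2.1] -/
theorem hasBoxLimit_boxLim [Nonempty α] {f : Finset (Site d) → α} (h : ∃ a, HasBoxLimit f a) :
    HasBoxLimit f (boxLim f) :=
  tendsto_nhds_limUnder h

end Limits

end Literature.Probability.LatticeModels
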